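import Mathlib
import Summits.Ventures.DiscreteObjects.Mahler.CyclotomicIntegerRamified
import Summits.Ventures.DiscreteObjects.Mahler.CyclotomicIntegerGaloisDescent
import Summits.Ventures.DiscreteObjects.Mahler.CyclotomicIntegerTwistFibre

/-!
# Lehmer's conjecture for ALL cyclotomic integers (venture `DiscreteObjects`, target L)

Cell `pub-namedobj`, seat `pub-namedobj-mahler-g28`. Framing: lottery ticket; floor = certified bounds/negative ranges.

[cite: BombieriGubler2001, Theorem 4.4.9] (F. Amoroso, R. Dvornicich, *A lower bound for the height in abelian
extensions*, J. Number Theory 80 (2000) 260–272), the integral case, in Mahler-measure form and with NO condition on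
the conductor: **for every `m ≥ 1`, every primitive `m`-th root of unity `ζ ∈ ℂ` and every `g ∈ ℤ[X]` such that
`α = g(ζ) ∈ ℤ[ζ_m]` is neither `0` nor a root of unity, `(5/2)^{deg α} ≤ M(α)^{10}`** (`cyclotomicInteger_lehmer_bound_all`;
`h(α) ≥ log(5/2)/10`), hence **`M(α) > M(ℓ) = 1.17628…`: Lehmer's conjecture holds for every cyclotomic integer**
(`lehmer_of_cyclotomicInteger_all`; `M(α)^5 ≥ 5/2` in degree `≥ 2`).  This removes the conductor restriction
`m < 3·5·…·31` of `CyclotomicIntegerSmallConductor` (Case I only).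

Proof = the printed one with `p = 5`, by strong induction on `m` (`cyclotomicInteger_prod_bound_five`, stated for the
product `∏_μ max(1,|g(μ)|)` over the primitive `m`-th roots of unity, `= M(α)^{φ(m)/deg α}`): `5 ∤ m` is Case I
(`CyclotomicIntegerMeasure`); for `m = 5n` and `σ_k` a generator of `Gal(ℚ(ζ_m)/ℚ(ζ_n))` (`CyclotomicIntegerGaloisDescent`)
either `α^5 ≠ σ_k(α^5)` — Case II (`CyclotomicIntegerRamified`) — or a root-of-unity twist `ζ^a α` is `σ_k`-invariant
(`CyclotomicIntegerTwistFibre`), hence equals `G(ζ^5)` with `G ∈ ℤ[X]` EXPLICITLY (`exists_descent_of_invariant`: the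
trace formula of `CyclotomicIntegerDescent` for `25 ∣ m`, the twisted trace formula for `5 ∥ m`), and the induction
hypothesis at the conductor `n` applies (fibres of `μ ↦ μ^5`, `prod_primitiveRoots_pow_prime_eq`).
REPLICATION of a published theorem (integral case; general `α ∈ ℚ(ζ_m)` have `M(α) ≥ 2` trivially when not integral);
no new mathematics claimed.
-/

namespace Summit.Ventures.DiscreteObjects.Mahler

open Polynomial Finset

/-- `1 ≤ ∏_μ max(1, |g(μ)|)` over the primitive `m`-th roots of unity. -/
theorem one_le_prod_primitiveRoots_max (m : ℕ) (g : ℤ[X]) : 1 ≤ ∏ μ ∈ primitiveRoots m ℂ, max 1 ‖aeval μ g‖ :=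
  Finset.prod_induction _ (fun x : ℝ => 1 ≤ x) (fun _ _ ha hb => one_le_mul_of_one_le_of_one_le ha hb) le_rfl
    (fun _ _ => le_max_left _ _)

/-- A cyclotomic integer `g(ζ)` is an algebraic integer. -/
theorem isIntegral_aeval_of_isPrimitiveRoot {m : ℕ} (hm : 0 < m) (g : ℤ[X]) {ζ : ℂ} (hζ : IsPrimitiveRoot ζ m) :
    IsIntegral ℤ (aeval ζ g) := by
  have hζint : IsIntegral ℤ ζ := hζ.isIntegral hm
  have hmem : aeval ζ g ∈ Algebra.adjoin ℤ {ζ} := Polynomial.aeval_mem_adjoin_singleton ℤ ζ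
  exact (mem_integralClosure_iff ℤ ℂ).1 (adjoin_le_integralClosure hζint hmem)

/-- **[BombieriGubler2001, Theorem 4.4.9] for cyclotomic integers, every conductor — product form.**  For every
`m ≥ 1`, every primitive `m`-th root of unity `ζ ∈ ℂ` and every `g ∈ ℤ[X]` with `g(ζ) ≠ 0` not a root of unity:
`(5/2)^{φ(m)} ≤ (∏_μ max(1, |g(μ)|))^{10}`, the product over the primitive `m`-th roots of unity.  Proof by strong
induction on `m` with the prime `p = 5`: `5 ∤ m` is Case I (`CyclotomicIntegerMeasure`, exponent `6 ≤ 10`); `5 ∣ m`,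
`m = 5n`: with `σ_k` a generator of `Gal(ℚ(ζ_m)/ℚ(ζ_n))` (`exists_galois_generator`) either `g(μ)^5 ≠ g(μ^k)^5`
for all `μ` (Case II, `CyclotomicIntegerRamified`, exponent `10`) or — degenerate case — a twist `ζ^a g(ζ)` is
`σ_k`-invariant (`exists_twist_invariant`), hence `= G(ζ^5)` with `G ∈ ℤ[X]` (`exists_descent_of_invariant`), the product
is `(∏_θ max(1,|G(θ)|))^{φ(m)/φ(n)}` (`prod_primitiveRoots_pow_prime_eq`), and the induction hypothesis at `n < m`
applies to `G(ζ^5) = ζ^a g(ζ)` (nonzero, not a root of unity). -/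
theorem cyclotomicInteger_prod_bound_five (m : ℕ) : 0 < m → ∀ (g : ℤ[X]) (ζ : ℂ), IsPrimitiveRoot ζ m →
    aeval ζ g ≠ 0 → (∀ j : ℕ, 0 < j → aeval ζ g ^ j ≠ 1) →
    ((5 : ℝ) / 2) ^ m.totient ≤ (∏ μ ∈ primitiveRoots m ℂ, max 1 ‖aeval μ g‖) ^ 10 := by
  induction m using Nat.strong_induction_on with
  | _ m ih =>
  intro hm0 g ζ hζ h0 hnu
  have hH1 : 1 ≤ ∏ μ ∈ primitiveRoots m ℂ, max 1 ‖aeval μ g‖ := one_le_prod_primitiveRoots_max m g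
  have hp5 : Nat.Prime 5 := Nat.prime_five
  by_cases h5 : 5 ∣ m
  · -- Case II: `m = 5 n`
    obtain ⟨n, hmn⟩ := h5
    have hn : 0 < n := by
      rcases Nat.eq_zero_or_pos n with h | h
      · rw [h, mul_zero] at hmn; omega
      · exact h
    have hnm : n < m := by omega
    obtain ⟨k, s, hk, hs, hkcop, hgen⟩ := exists_galois_generator hp5 (by norm_num) hn
    have hkm : k.Coprime m := by rw [hmn]; exact hkcop
    have hkmod : k % (m / 5) = 1 % (m / 5) := by
      rw [hmn, Nat.mul_div_cancel_left n (by norm_num : 0 < 5), hk, Nat.add_mul_mod_self_left]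
    by_cases hdeg : ∃ μ ∈ primitiveRoots m ℂ, aeval μ g ^ 5 = aeval (μ ^ k) g ^ 5
    · -- degenerate case: twist, descend, induct
      have hdeg' : aeval (ζ ^ k) g ^ 5 = aeval ζ g ^ 5 := aeval_pow_pow_eq_of_exists hm0 g hζ hdeg
      obtain ⟨a, hinv⟩ := exists_twist_invariant hm0 hp5 hmn hk hs g hζ h0 hdeg'
      obtain ⟨G, hG⟩ := exists_descent_of_invariant hm0 hp5 hmn hn hk hs hkcop hgen (X ^ a * g) hζ hinv
      have hθ : IsPrimitiveRoot (ζ ^ 5) n := hζ.pow hm0 hmn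
      have hζ0 : ζ ≠ 0 := hζ.ne_zero hm0.ne'
      have hval : aeval (ζ ^ 5) G = ζ ^ a * aeval ζ g := by rw [← hG, map_mul, map_pow, aeval_X]
      have hG0 : aeval (ζ ^ 5) G ≠ 0 := by
        rw [hval]; exact mul_ne_zero (pow_ne_zero _ hζ0) h0
      have hGnu : ∀ j : ℕ, 0 < j → aeval (ζ ^ 5) G ^ j ≠ 1 := by
        intro j hj hj1
        apply hnu (j * m) (Nat.mul_pos hj hm0)
        have h1 : (ζ ^ a * aeval ζ g) ^ (j * m) = 1 := by rw [← hval, pow_mul, hj1, one_pow]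
        rw [mul_pow, ← pow_mul, show a * (j * m) = m * (a * j) by ring, pow_mul, hζ.pow_eq_one, one_pow,
          one_mul] at h1
        exact h1
      have hIH := ih n hnm hn G (ζ ^ 5) hθ hG0 hGnu
      -- every primitive `μ`: `(X^a g)(μ) = G(μ^5)`
      have hall : ∀ μ ∈ primitiveRoots m ℂ, aeval μ (X ^ a * g) = aeval (μ ^ 5) G := by
        intro μ hμ
        have hμ' := (mem_primitiveRoots hm0).1 hμ
        set Q : ℤ[X] := X ^ a * g - expand ℤ 5 G with hQ
        have hQζ : aeval ζ Q = 0 := by rw [hQ, map_sub, expand_aeval, hG, sub_self]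
        have hQμ := aeval_eq_zero_of_primitiveRoot hm0 hζ hQζ hμ'
        rwa [hQ, map_sub, expand_aeval, sub_eq_zero] at hQμ
      have hH : ∏ μ ∈ primitiveRoots m ℂ, max 1 ‖aeval μ g‖ =
          ∏ μ ∈ primitiveRoots m ℂ, max 1 ‖aeval (μ ^ 5) G‖ := by
        refine Finset.prod_congr rfl fun μ hμ => ?_
        rw [← hall μ hμ, map_mul, map_pow, aeval_X, norm_mul, norm_pow,
          ((mem_primitiveRoots hm0).1 hμ).norm'_eq_one hm0.ne', one_pow, one_mul]
      obtain ⟨e, he⟩ : ∃ e : ℕ, m.totient = e * n.totient := by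
        by_cases h5n : 5 ∣ n
        · exact ⟨5, by rw [hmn, Nat.totient_mul_of_prime_of_dvd hp5 h5n]⟩
        · exact ⟨5 - 1, by rw [hmn, Nat.totient_mul_of_prime_of_not_dvd hp5 h5n]⟩
      have hfib : ∏ μ ∈ primitiveRoots m ℂ, max 1 ‖aeval (μ ^ 5) G‖ =
          (∏ θ ∈ primitiveRoots n ℂ, max 1 ‖aeval θ G‖) ^ e :=
        prod_primitiveRoots_pow_prime_eq hm0 hp5 hmn hn he (fun z => max 1 ‖aeval z G‖)
      have hR : ((∏ θ ∈ primitiveRoots n ℂ, max 1 ‖aeval θ G‖) ^ e) ^ 10 =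
          ((∏ θ ∈ primitiveRoots n ℂ, max 1 ‖aeval θ G‖) ^ 10) ^ e := by
        rw [← pow_mul, ← pow_mul, mul_comm]
      rw [hH, hfib, hR, he, mul_comm e, pow_mul]
      exact pow_le_pow_left₀ (by positivity) hIH e
    · -- nondegenerate case: the ramified bound
      have hsep : ∀ μ ∈ primitiveRoots m ℂ, aeval μ g ^ 5 ≠ aeval (μ ^ k) g ^ 5 :=
        fun μ hμ heq => hdeg ⟨μ, hμ, heq⟩
      have hB := cyclotomicInteger_measure_bound_ramified hm0 hp5 ⟨n, hmn⟩ hkmod hkm g hsep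
      exact hB
  · -- Case I
    have hcop : (5 : ℕ).Coprime m := (Nat.Prime.coprime_iff_not_dvd hp5).2 h5
    have hsep := pow_ne_aeval_pow_of_not_torsion hm0 hp5 hcop g hζ h0 hnu
    have hB := cyclotomicInteger_measure_bound hm0 hp5 hcop g hsep
    exact hB.trans (pow_le_pow_right₀ hH1 (by norm_num))

/-- The product `∏_μ max(1,|g(μ)|)` over the primitive `m`-th roots of unity is `M(minpoly_ℤ g(ζ))^e` with
`e · deg = φ(m)` (the polynomial `∏_μ (X - g(μ)) ∈ ℤ[X]` is a power of the minimal polynomial). -/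
theorem exists_prod_max_eq_measure_pow {m : ℕ} (hm : 0 < m) (g : ℤ[X]) {ζ : ℂ} (hζ : IsPrimitiveRoot ζ m) :
    ∃ e : ℕ, e ≠ 0 ∧ e * (minpoly ℤ (aeval ζ g)).natDegree = m.totient ∧
      ∏ μ ∈ primitiveRoots m ℂ, max 1 ‖aeval μ g‖ = intMahlerMeasure (minpoly ℤ (aeval ζ g)) ^ e := by
  classical
  have hαint : IsIntegral ℤ (aeval ζ g) := isIntegral_aeval_of_isPrimitiveRoot hm g hζ
  set f : ℤ[X] := minpoly ℤ (aeval ζ g) with hf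
  have hfmon : f.Monic := minpoly.monic hαint
  have hfirr : Irreducible f := minpoly.irreducible hαint
  have hroot : ∀ μ : ℂ, IsPrimitiveRoot μ m → aeval (aeval μ g) f = 0 := by
    intro μ hμ
    have h1 : aeval ζ (f.comp g) = 0 := by rw [aeval_comp, hf, minpoly.aeval]
    have h2 := aeval_eq_zero_of_primitiveRoot hm hζ h1 hμ
    rwa [aeval_comp] at h2
  set Fc : ℂ[X] := ∏ μ ∈ primitiveRoots m ℂ, (X - C (aeval μ g)) with hFc
  have hFcmon : Fc.Monic := monic_prod_of_monic _ _ (fun _ _ => monic_X_sub_C _)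
  obtain ⟨F, hFmap, hFdeg, hFmon⟩ :=
    lifts_and_natDegree_eq_and_monic (prod_X_sub_C_aeval_primitiveRoots_lifts hm g) hFcmon
  have hFcdeg : Fc.natDegree = m.totient := by
    rw [hFc, natDegree_prod_of_monic _ _ (fun _ _ => monic_X_sub_C _)]
    simp only [natDegree_X_sub_C, Finset.sum_const, smul_eq_mul, mul_one]
    exact (Complex.isPrimitiveRoot_exp m hm.ne').card_primitiveRoots
  have hFroots : ∀ z : ℂ, z ∈ (F.map (Int.castRingHom ℂ)).roots → aeval z f = 0 := by
    intro z hz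
    have hmm : ((primitiveRoots m ℂ).val.map fun μ => X - C (aeval μ g)) =
        (((primitiveRoots m ℂ).val.map fun μ => aeval μ g).map fun a : ℂ => X - C a) := by
      rw [Multiset.map_map]
      rfl
    rw [hFmap, Finset.prod_eq_multiset_prod, hmm, roots_multiset_prod_X_sub_C, Multiset.mem_map] at hz
    obtain ⟨μ, hμ, rfl⟩ := hz
    exact hroot μ ((mem_primitiveRoots hm).1 (Finset.mem_def.2 hμ))
  obtain ⟨e, hFe⟩ := eq_pow_of_roots_subset hfmon hfirr _ F rfl hFmon hFroots
  have hed : e * f.natDegree = m.totient := by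
    rw [← hFcdeg, ← hFdeg, hFe, natDegree_pow]
  have he0 : e ≠ 0 := by
    intro he
    rw [he, zero_mul] at hed
    exact (Nat.totient_pos.2 hm).ne' hed.symm
  have hMF : intMahlerMeasure F = ∏ μ ∈ primitiveRoots m ℂ, max 1 ‖aeval μ g‖ := by
    unfold intMahlerMeasure
    rw [hFmap, mahlerMeasure_prod_X_sub_C]
  have hMFe : intMahlerMeasure F = intMahlerMeasure f ^ e := by rw [hFe, intMahlerMeasure_pow]
  exact ⟨e, he0, hed, by rw [← hMF, hMFe]⟩

/-- **[BombieriGubler2001, Theorem 4.4.9] (Amoroso–Dvornicich 2000) for cyclotomic integers, EVERY conductor `m`,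
in Mahler-measure form.**  Let `ζ ∈ ℂ` be a primitive `m`-th root of unity (`m ≥ 1`), `g ∈ ℤ[X]`, and
`α = g(ζ) ∈ ℤ[ζ_m]` neither `0` nor a root of unity.  Then `(5/2)^{deg α} ≤ M(α)^{10}`, i.e. the height bound
`h(α) ≥ log(5/2)/10` — with no condition on `m`. -/
theorem cyclotomicInteger_lehmer_bound_all {m : ℕ} (hm : 0 < m) (g : ℤ[X]) {ζ : ℂ} (hζ : IsPrimitiveRoot ζ m)
    (h0 : aeval ζ g ≠ 0) (hnu : ∀ k : ℕ, 0 < k → aeval ζ g ^ k ≠ 1) :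
    ((5 : ℝ) / 2) ^ (minpoly ℤ (aeval ζ g)).natDegree ≤ intMahlerMeasure (minpoly ℤ (aeval ζ g)) ^ 10 := by
  obtain ⟨e, he0, hed, hprod⟩ := exists_prod_max_eq_measure_pow hm g hζ
  have hB := cyclotomicInteger_prod_bound_five m hm g ζ hζ h0 hnu
  set M := intMahlerMeasure (minpoly ℤ (aeval ζ g)) with hM
  set d := (minpoly ℤ (aeval ζ g)).natDegree with hd
  have hR : (M ^ e) ^ 10 = (M ^ 10) ^ e := by rw [← pow_mul, ← pow_mul, mul_comm]
  rw [hprod, ← hed, hR, mul_comm e d, pow_mul] at hB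
  have hM0 : 0 ≤ M :=
    le_trans zero_le_one (one_le_intMahlerMeasure (minpoly.monic (isIntegral_aeval_of_isPrimitiveRoot hm g hζ)).ne_zero)
  exact (pow_le_pow_iff_left₀ (by positivity) (by positivity) he0).1 hB

/-- **Lehmer's conjecture for ALL cyclotomic integers.**  For every `m ≥ 1`, every primitive `m`-th root of unity
`ζ ∈ ℂ` and every `g ∈ ℤ[X]` such that `α = g(ζ)` is neither `0` nor a root of unity: `M(α) > M(ℓ) = 1.17628…`
(Lehmer's number).  In degree `≥ 2` indeed `M(α) ≥ (5/2)^{1/5} = 1.2011…` (`five_halves_le_measure_pow_five`); in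
degree `1`, `|α| ≥ 2`.  By Kronecker–Weber (not used here) the elements of the rings `ℤ[ζ_m]` are exactly the
algebraic integers of the abelian extensions of `ℚ`. -/
theorem lehmer_of_cyclotomicInteger_all {m : ℕ} (hm : 0 < m) (g : ℤ[X]) {ζ : ℂ} (hζ : IsPrimitiveRoot ζ m)
    (h0 : aeval ζ g ≠ 0) (hnu : ∀ k : ℕ, 0 < k → aeval ζ g ^ k ≠ 1) :
    intMahlerMeasure lehmerPoly < intMahlerMeasure (minpoly ℤ (aeval ζ g)) := by
  have hB := cyclotomicInteger_lehmer_bound_all hm g hζ h0 hnu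
  have hL := lehmer_measure_upper_bound
  have hαint : IsIntegral ℤ (aeval ζ g) := isIntegral_aeval_of_isPrimitiveRoot hm g hζ
  set M := intMahlerMeasure (minpoly ℤ (aeval ζ g)) with hM
  have hdpos : 0 < (minpoly ℤ (aeval ζ g)).natDegree := minpoly.natDegree_pos hαint
  have hM1 : 1 ≤ M := one_le_intMahlerMeasure (minpoly.monic hαint).ne_zero
  have hL0 : 0 ≤ intMahlerMeasure lehmerPoly :=
    le_trans zero_le_one (one_le_intMahlerMeasure lehmerPoly_monic.ne_zero)
  rcases Nat.lt_or_ge (minpoly ℤ (aeval ζ g)).natDegree 2 with hd1 | hd2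
  · have h2 := two_le_measure_of_natDegree_minpoly_eq_one hαint h0 hnu (by omega)
    linarith
  · have h52 : (1 : ℝ) ≤ 5 / 2 := by norm_num
    have hsq : ((5 : ℝ) / 2) ^ 2 ≤ M ^ 10 := (pow_le_pow_right₀ h52 hd2).trans hB
    by_contra hle
    have hle' : M ≤ intMahlerMeasure lehmerPoly := le_of_not_gt hle
    have h1 := pow_le_pow_left₀ (le_trans zero_le_one hM1) hle' 10
    have h2 := pow_le_pow_left₀ hL0 hL.le 10
    have h3 : ((117629 : ℝ) / 100000) ^ 10 < ((5 : ℝ) / 2) ^ 2 := by norm_num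
    linarith

/-- In degree `≥ 2`: `M(α)^5 ≥ 5/2`, i.e. `M(α) ≥ 1.2011…`, for every nonzero non-torsion cyclotomic integer `α`. -/
theorem five_halves_le_measure_pow_five {m : ℕ} (hm : 0 < m) (g : ℤ[X]) {ζ : ℂ} (hζ : IsPrimitiveRoot ζ m)
    (h0 : aeval ζ g ≠ 0) (hnu : ∀ k : ℕ, 0 < k → aeval ζ g ^ k ≠ 1) (hd : 2 ≤ (minpoly ℤ (aeval ζ g)).natDegree) :
    (5 : ℝ) / 2 ≤ intMahlerMeasure (minpoly ℤ (aeval ζ g)) ^ 5 := by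
  have hB := cyclotomicInteger_lehmer_bound_all hm g hζ h0 hnu
  have hM0 : 0 ≤ intMahlerMeasure (minpoly ℤ (aeval ζ g)) :=
    le_trans zero_le_one (one_le_intMahlerMeasure (minpoly.monic (isIntegral_aeval_of_isPrimitiveRoot hm g hζ)).ne_zero)
  have h1 : ((5 : ℝ) / 2) ^ 2 ≤ (intMahlerMeasure (minpoly ℤ (aeval ζ g)) ^ 5) ^ 2 := by
    rw [← pow_mul]
    exact (pow_le_pow_right₀ (by norm_num) hd).trans hB
  exact (pow_le_pow_iff_left₀ (by norm_num) (by positivity) two_ne_zero).1 h1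

end Summit.Ventures.DiscreteObjects.Mahler
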